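import Literature.Analysis.FluidPDE.DuchonRobertInviscidLimit
import Literature.Analysis.FunctionSpaces.TorusSobolevNormFacts
import Literature.Analysis.FunctionSpaces.TorusSobolevNormProofs
import Literature.Analysis.FunctionSpaces.TorusFourierCalculus
import Mathlib.MeasureTheory.Constructions.Polish.StronglyMeasurable
import HarnessLib

/-!
# Buckmaster–Vicol 2019, Thm. 1.2 — proof architecture, II: the analysis of the limit step
  (§2.4) — interpolation `L²/H¹`, `L²`-Cauchy sequences of fields, weak solutions under strong
  `L²_{t,x}` limits at fixed viscosity

Sibling proof file of the barrier entry
`Literature/Barriers/NavierStokesRegularity/BuckmasterVicolNonuniqueness` (D-0021). This file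
contains no statement specific to Buckmaster–Vicol: it proves the standard facts that the printed
proof of Thm. 1.2 (§2.4, pp. 5–6 of arXiv:1709.10033) invokes in one sentence each —
"(2.8) and interpolation implies `∑ ‖v_{q+1} - v_q‖_{H^{β'}} ≲ ∑ ‖v_{q+1} - v_q‖_{L²}^{1-β'}
(‖v_{q+1}‖_{C¹} + ‖v_q‖_{C¹})^{β'}`", "`v = ∑ (v_{q+1} - v_q)` converges in `C⁰_t H^{β''}_x`", and
"since `‖R̊_q‖_{L¹} → 0` as `q → ∞`, `v` is a weak solution of the Navier–Stokes equation" — on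
the tree's flat unit torus with the spectral Sobolev norms of `TorusSobolevNorm`:

* `eSobolevNorm_le_interpolate` — `‖f‖_{H^s} ≤ ‖f‖_{H⁰}^{1-s} ‖f‖_{H¹}^s`, `0 ≤ s ≤ 1` (Hölder on
  the Fourier side);
* `eSobolevNorm_one_complexify_le_of_bounds` — `‖v‖_{H¹} ≤ ‖v‖_{C⁰} + ∑ᵢ ‖∂ᵢ v‖_{C⁰}` for smooth
  real fields (from the proved `H¹` identity `Torus.eSobolevNorm_one_complexify_sq`);
* `eSobolevNorm_le_of_tendsto` — the `H^s` ball is closed under `L¹` convergence (Fatou on the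
  Fourier side);
* `ae_cauchySeq_of_summable_eLpNorm`, `eLpNorm_limUnder_sub_le_tsum` — a sequence of fields with
  summable `L²` increments converges a.e., and its pointwise limit is within the tail sum of the
  sequence in `L²` (Fatou);
* `isWeakNSSolutionOn_of_tendsto_L2` — strong `L²((0,T) × T³)` limits of weak Navier–Stokes
  solutions with a fixed viscosity are weak solutions (the fixed-`ν` twin of the tree's
  `Torus.isWeakEulerSolutionOn_of_inviscidLimit`, whose Cauchy–Schwarz bookkeeping is reused by
  absorbing the viscous term into the linear one).

## References

* T. Buckmaster, V. Vicol, Ann. of Math. 189 (2019), §2.4 (proof of Thm. 1.2).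
  [`BuckmasterVicol2019AnnMath`]
* H. Bahouri, J.-Y. Chemin, R. Danchin, *Fourier Analysis and Nonlinear PDEs* (2011), Prop. 1.32
  (interpolation in `H^s`); L. Grafakos, *Classical Fourier Analysis* (2014), §3.3.
-/

noncomputable section

open MeasureTheory Set Filter Function UnitAddTorus
open scoped ENNReal NNReal InnerProductSpace Topology

namespace Literature.Barriers.NavierStokesRegularity

open Literature.Analysis.FunctionSpaces Literature.Analysis.FluidPDE

/-! ## Interpolation between `H⁰` and `H¹` -/

section Interpolation

variable {d : Type*} [Fintype d]
variable {F : Type*} [NormedAddCommGroup F] [NormedSpace ℂ F]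

/-- The squared Sobolev weight as an extended real power: `ofReal (⟨k⟩^s)² = (ofReal ⟨k⟩²)^s`.
[folklore] -/
theorem ofReal_sobolevWeight_sq (s : ℝ) (k : d → ℤ) :
    ENNReal.ofReal (Torus.sobolevWeight s k ^ 2) =
      ENNReal.ofReal (1 + Torus.freqNormSq k) ^ s := by
  have h0 : 0 < 1 + Torus.freqNormSq k := by linarith [Torus.freqNormSq_nonneg k]
  rw [Torus.sobolevWeight, ← Real.rpow_mul_natCast h0.le, ENNReal.ofReal_rpow_of_pos h0]
  norm_num

/-- **Interpolation `‖f‖_{H^s} ≤ ‖f‖_{H⁰}^{1-s} ‖f‖_{H¹}^s` for `0 ≤ s ≤ 1`** (Hölder's inequality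
with exponents `1/s`, `1/(1-s)` on the Fourier side: `⟨k⟩^{2s}|f̂|² = (⟨k⟩²|f̂|²)^s (|f̂|²)^{1-s}`;
Bahouri–Chemin–Danchin, Prop. 1.32). No integrability is needed (all three norms are computed
from the same coefficients). [folklore] -/
theorem eSobolevNorm_le_interpolate {s : ℝ} (hs0 : 0 ≤ s) (hs1 : s ≤ 1) (f : UnitAddTorus d → F) :
    Torus.eSobolevNorm s f ≤ Torus.eSobolevNorm 0 f ^ (1 - s) * Torus.eSobolevNorm 1 f ^ s := by
  rcases hs0.eq_or_lt with rfl | hs0'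
  · simp
  rcases hs1.eq_or_lt' with rfl | hs1'
  · simp
  -- notation
  set c : (d → ℤ) → ℝ≥0∞ := fun k => ‖mFourierCoeff f k‖ₑ ^ 2 with hc
  set W : (d → ℤ) → ℝ≥0∞ := fun k => ENNReal.ofReal (1 + Torus.freqNormSq k) with hW
  have hSs : ∀ r : ℝ, Torus.eSobolevNorm r f = (∑' k, W k ^ r * c k) ^ (1 / 2 : ℝ) := by
    intro r
    rw [Torus.eSobolevNorm]
    congr 1
    refine tsum_congr fun k => ?_
    rw [ofReal_sobolevWeight_sq]
  -- pointwise splitting of the summand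
  have hsplit : ∀ k, W k ^ s * c k = (W k * c k) ^ s * c k ^ (1 - s) := by
    intro k
    rw [ENNReal.mul_rpow_of_nonneg _ _ hs0, mul_assoc, ← ENNReal.rpow_add_of_nonneg s (1 - s) hs0
      (by linarith), add_sub_cancel, ENNReal.rpow_one]
  -- Hölder for the counting measure
  have hpq : (1 / s).HolderConjugate (1 / (1 - s)) := by
    rw [Real.holderConjugate_iff]
    refine ⟨by rw [lt_div_iff₀ hs0']; linarith, ?_⟩
    simp only [one_div, inv_inv]
    ring
  have hH := ENNReal.lintegral_mul_le_Lp_mul_Lq (Measure.count : Measure (d → ℤ)) hpq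
    (f := fun k => (W k * c k) ^ s) (g := fun k => c k ^ (1 - s))
    Measurable.of_discrete.aemeasurable Measurable.of_discrete.aemeasurable
  simp only [Pi.mul_apply, lintegral_count, one_div_one_div] at hH
  have h1 : ∀ k, ((W k * c k) ^ s) ^ (1 / s) = W k * c k := fun k => by
    rw [one_div, ENNReal.rpow_rpow_inv hs0'.ne']
  have h2 : ∀ k, (c k ^ (1 - s)) ^ (1 / (1 - s)) = c k := fun k => by
    rw [one_div, ENNReal.rpow_rpow_inv (by linarith)]
  simp_rw [h1, h2] at hH
  -- assemble
  have hsum : ∑' k, W k ^ s * c k ≤ (∑' k, W k * c k) ^ s * (∑' k, c k) ^ (1 - s) := by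
    calc ∑' k, W k ^ s * c k = ∑' k, (W k * c k) ^ s * c k ^ (1 - s) := tsum_congr hsplit
      _ ≤ _ := hH
  rw [hSs s, hSs 0, hSs 1]
  simp only [ENNReal.rpow_zero, one_mul, ENNReal.rpow_one]
  calc (∑' k, W k ^ s * c k) ^ (1 / 2 : ℝ)
      ≤ ((∑' k, W k * c k) ^ s * (∑' k, c k) ^ (1 - s)) ^ (1 / 2 : ℝ) :=
        ENNReal.rpow_le_rpow hsum (by norm_num)
    _ = ((∑' k, c k) ^ (1 / 2 : ℝ)) ^ (1 - s) * ((∑' k, W k * c k) ^ (1 / 2 : ℝ)) ^ s := by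
        rw [ENNReal.mul_rpow_of_nonneg _ _ (by norm_num : (0 : ℝ) ≤ 1 / 2), ← ENNReal.rpow_mul,
          ← ENNReal.rpow_mul, ← ENNReal.rpow_mul, ← ENNReal.rpow_mul, mul_comm]
        congr 2 <;> ring

end Interpolation

/-! ## The `H¹` norm of a smooth real field from sup bounds -/

section H1Bound

variable {d : Type*} [Fintype d] [DecidableEq d]

/-- **`‖v‖_{H¹} ≤ ‖v‖_{C⁰} + ∑ᵢ ‖∂ᵢ v‖_{C⁰}` for smooth real vector fields on `T^d`** (unit torus,
probability measure, spectral norm of the complexified field): from the proved identity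
`‖v‖²_{H¹} = ∫‖v‖² + (4π²)⁻¹ ∫ ∑ᵢ ‖∂ᵢ v‖²` (`Torus.eSobolevNorm_one_complexify_sq`) and
`(4π²)⁻¹ ≤ 1`. [folklore] -/
theorem eSobolevNorm_one_complexify_le_of_bounds {v : UnitAddTorus d → EuclideanSpace ℝ d}
    (hv : Torus.IsSmooth v) {B₀ : ℝ} {B₁ : d → ℝ} (h0 : ∀ x, ‖v x‖ ≤ B₀)
    (h1 : ∀ i x, ‖Torus.partialDeriv i v x‖ ≤ B₁ i) :
    Torus.eSobolevNorm 1 (EuclideanSpace.complexify ∘ v) ≤ ENNReal.ofReal (B₀ + ∑ i, B₁ i) := by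
  classical
  have hB₀ : 0 ≤ B₀ := (norm_nonneg _).trans (h0 0)
  have hB₁ : ∀ i, 0 ≤ B₁ i := fun i => (norm_nonneg _).trans (h1 i 0)
  -- bounds of the two integrals
  have hI0 : ∫ x, ‖v x‖ ^ 2 ≤ B₀ ^ 2 := by
    calc ∫ x, ‖v x‖ ^ 2 ≤ ∫ _ : UnitAddTorus d, B₀ ^ 2 :=
          integral_mono (hv.continuous.norm.pow 2).integrable_unitAddTorus (integrable_const _)
            fun x => pow_le_pow_left₀ (norm_nonneg _) (h0 x) 2
      _ = B₀ ^ 2 := by simp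
  have hI1 : Torus.gradNormSq v ≤ ∑ i, B₁ i ^ 2 := by
    rw [Torus.gradNormSq]
    calc ∫ x, ∑ i, ‖Torus.partialDeriv i v x‖ ^ 2 ≤ ∫ _ : UnitAddTorus d, ∑ i, B₁ i ^ 2 :=
          integral_mono ((continuous_finsetSum _ fun i _ =>
            ((hv.partialDeriv i).continuous.norm.pow 2)).integrable_unitAddTorus)
            (integrable_const _)
            fun x => Finset.sum_le_sum fun i _ => pow_le_pow_left₀ (norm_nonneg _) (h1 i x) 2
      _ = ∑ i, B₁ i ^ 2 := by simp
  have hπ : (4 * Real.pi ^ 2)⁻¹ ≤ 1 := by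
    rw [inv_le_one_iff₀]
    right
    nlinarith [Real.pi_gt_three]
  have hsq : (∫ x, ‖v x‖ ^ 2) + (4 * Real.pi ^ 2)⁻¹ * Torus.gradNormSq v ≤ (B₀ + ∑ i, B₁ i) ^ 2 := by
    have hg0 : 0 ≤ Torus.gradNormSq v := Torus.gradNormSq_nonneg v
    have hS0 : 0 ≤ ∑ i, B₁ i := Finset.sum_nonneg fun i _ => hB₁ i
    have hsum_sq : ∑ i, B₁ i ^ 2 ≤ (∑ i, B₁ i) ^ 2 := by
      rw [sq, Finset.sum_mul_sum]
      refine Finset.sum_le_sum fun i hi => ?_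
      rw [sq]
      exact Finset.single_le_sum (f := fun j => B₁ i * B₁ j)
        (fun j _ => mul_nonneg (hB₁ i) (hB₁ j)) hi
    calc (∫ x, ‖v x‖ ^ 2) + (4 * Real.pi ^ 2)⁻¹ * Torus.gradNormSq v
        ≤ B₀ ^ 2 + 1 * (∑ i, B₁ i) ^ 2 := by
          refine add_le_add hI0 ?_
          exact mul_le_mul hπ (hI1.trans hsum_sq) hg0 zero_le_one
      _ ≤ (B₀ + ∑ i, B₁ i) ^ 2 := by nlinarith [mul_nonneg hB₀ hS0]
  -- take square roots
  have h2 : Torus.eSobolevNorm 1 (EuclideanSpace.complexify ∘ v) ^ 2 ≤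
      ENNReal.ofReal (B₀ + ∑ i, B₁ i) ^ 2 := by
    rw [Torus.eSobolevNorm_one_complexify_sq hv,
      ← ENNReal.ofReal_pow (add_nonneg hB₀ (Finset.sum_nonneg fun i _ => hB₁ i))]
    exact ENNReal.ofReal_le_ofReal hsq
  exact (ENNReal.pow_le_pow_left_iff two_ne_zero).1 h2

end H1Bound

/-! ## The `H^s` ball is closed under `L¹` convergence -/

section LowerSemicontinuity

variable {d : Type*} [Fintype d]
variable {F : Type*} [NormedAddCommGroup F] [NormedSpace ℂ F]

/-- Fourier coefficients are `1`-Lipschitz from `L¹`: `‖𝓕g(k)‖ ≤ ∫ ‖g‖` for integrable `g`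
(the character has modulus `≤ 1`). [folklore] -/
theorem norm_mFourierCoeff_le_integral_norm {g : UnitAddTorus d → F} (hg : Integrable g volume)
    (k : d → ℤ) : ‖mFourierCoeff g k‖ ≤ ∫ x, ‖g x‖ := by
  rw [Torus.mFourierCoeff_eq_integral_volume]
  refine (norm_integral_le_integral_norm _).trans
    (integral_mono_of_nonneg (ae_of_all _ fun x => norm_nonneg _) hg.norm
      (ae_of_all _ fun x => ?_))
  dsimp only
  rw [norm_smul]
  exact mul_le_of_le_one_left (norm_nonneg _)
    (((mFourier (-k)).norm_coe_le_norm x).trans_eq mFourier_norm)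

/-- **The `H^s` ball is closed under `L¹` convergence** (lower semicontinuity of the spectral
norm): if `f_n → g` in `L¹(T^d)` (all integrable) and `‖f_n‖_{H^s} ≤ C` for all `n`, then
`‖g‖_{H^s} ≤ C`. Proof: the Fourier coefficients converge (`‖𝓕(f_n - g)(k)‖ ≤ ‖f_n - g‖_{L¹}`)
and Fatou's lemma on `ℤ^d`. [folklore] -/
theorem eSobolevNorm_le_of_tendsto [CompleteSpace F] {s : ℝ} {f : ℕ → UnitAddTorus d → F}
    {g : UnitAddTorus d → F} {C : ℝ≥0∞} (hf : ∀ n, Integrable (f n) volume) (hg : Integrable g volume)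
    (hconv : Tendsto (fun n => ∫ x, ‖f n x - g x‖) atTop (𝓝 0))
    (hC : ∀ n, Torus.eSobolevNorm s (f n) ≤ C) : Torus.eSobolevNorm s g ≤ C := by
  -- coefficientwise convergence
  have hcoef : ∀ k, Tendsto (fun n => mFourierCoeff (f n) k) atTop (𝓝 (mFourierCoeff g k)) := by
    intro k
    rw [tendsto_iff_norm_sub_tendsto_zero]
    refine squeeze_zero (fun n => norm_nonneg _) (fun n => ?_) hconv
    have hsub : mFourierCoeff (f n) k - mFourierCoeff g k = mFourierCoeff (f n - g) k := by
      rw [sub_eq_add_neg, sub_eq_add_neg, Torus.mFourierCoeff_add (hf n) hg.neg,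
        Torus.mFourierCoeff_neg]
    rw [hsub]
    exact norm_mFourierCoeff_le_integral_norm ((hf n).sub hg) k
  set W : (d → ℤ) → ℝ≥0∞ := fun k => ENNReal.ofReal (Torus.sobolevWeight s k ^ 2) with hW
  have hterm : ∀ k, Tendsto (fun n => W k * ‖mFourierCoeff (f n) k‖ₑ ^ 2) atTop
      (𝓝 (W k * ‖mFourierCoeff g k‖ₑ ^ 2)) := fun k =>
    ENNReal.Tendsto.const_mul (ENNReal.Tendsto.pow (hcoef k).enorm) (Or.inr ENNReal.ofReal_ne_top)
  -- the bound on the approximants, squared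
  have hsq : ∀ n, ∑' k, W k * ‖mFourierCoeff (f n) k‖ₑ ^ 2 ≤ C ^ 2 := by
    intro n
    have h := hC n
    rw [Torus.eSobolevNorm] at h
    calc ∑' k, W k * ‖mFourierCoeff (f n) k‖ₑ ^ 2
        = ((∑' k, W k * ‖mFourierCoeff (f n) k‖ₑ ^ 2) ^ (1 / 2 : ℝ)) ^ 2 :=
          (ENNReal.rpow_half_sq _).symm
      _ ≤ C ^ 2 := by gcongr
  -- Fatou on `ℤ^d`
  have hlim : ∑' k, W k * ‖mFourierCoeff g k‖ₑ ^ 2 ≤ C ^ 2 := by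
    calc ∑' k, W k * ‖mFourierCoeff g k‖ₑ ^ 2
        = ∑' k, liminf (fun n => W k * ‖mFourierCoeff (f n) k‖ₑ ^ 2) atTop :=
          tsum_congr fun k => ((hterm k).liminf_eq).symm
      _ = ∫⁻ k, liminf (fun n => W k * ‖mFourierCoeff (f n) k‖ₑ ^ 2) atTop ∂Measure.count :=
          (lintegral_count _).symm
      _ ≤ liminf (fun n => ∫⁻ k, W k * ‖mFourierCoeff (f n) k‖ₑ ^ 2 ∂Measure.count) atTop :=
          lintegral_liminf_le' fun n => Measurable.of_discrete.aemeasurable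
      _ = liminf (fun n => ∑' k, W k * ‖mFourierCoeff (f n) k‖ₑ ^ 2) atTop := by
          simp_rw [lintegral_count]
      _ ≤ C ^ 2 := liminf_le_of_frequently_le (Eventually.of_forall hsq).frequently
  rw [Torus.eSobolevNorm]
  calc (∑' k, W k * ‖mFourierCoeff g k‖ₑ ^ 2) ^ (1 / 2 : ℝ) ≤ (C ^ 2) ^ (1 / 2 : ℝ) :=
        ENNReal.rpow_le_rpow hlim (by norm_num)
    _ = C := by
        rw [← ENNReal.rpow_natCast, ← ENNReal.rpow_mul]
        norm_num

end LowerSemicontinuity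

/-! ## `L²`-Cauchy sequences of fields: a.e. convergence and the Fatou tail bound -/

section L2Cauchy

variable {α : Type*} [MeasurableSpace α] {μ : Measure α}
variable {E : Type*} [NormedAddCommGroup E]

/-- `‖f‖²_{L²} = ∫ ‖f‖²` (lower integral). [folklore] -/
theorem eLpNorm_two_sq_eq_lintegral (f : α → E) : eLpNorm f 2 μ ^ 2 = ∫⁻ x, ‖f x‖ₑ ^ 2 ∂μ := by
  rw [eLpNorm_eq_lintegral_rpow_enorm_toReal two_ne_zero ENNReal.ofNat_ne_top,
    ENNReal.toReal_ofNat, ENNReal.rpow_half_sq]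
  simp_rw [ENNReal.rpow_two]

/-- Telescoping: `‖w_{q+m} - w_q‖_{L²} ≤ ∑_{i<m} ε_{q+i}` when `‖w_{n+1} - w_n‖_{L²} ≤ ε_n`.
[folklore] -/
theorem eLpNorm_sub_le_sum_of_le {w : ℕ → α → E} {ε : ℕ → ℝ≥0∞}
    (hw : ∀ n, AEStronglyMeasurable (w n) μ) (hε : ∀ n, eLpNorm (w (n + 1) - w n) 2 μ ≤ ε n)
    (q m : ℕ) : eLpNorm (w (q + m) - w q) 2 μ ≤ ∑ i ∈ Finset.range m, ε (q + i) := by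
  induction m with
  | zero => simp
  | succ m ih =>
    have hsplit : w (q + (m + 1)) - w q = (w (q + m + 1) - w (q + m)) + (w (q + m) - w q) := by
      rw [← add_assoc]; abel
    rw [hsplit, Finset.sum_range_succ]
    calc eLpNorm ((w (q + m + 1) - w (q + m)) + (w (q + m) - w q)) 2 μ
        ≤ eLpNorm (w (q + m + 1) - w (q + m)) 2 μ + eLpNorm (w (q + m) - w q) 2 μ :=
          eLpNorm_add_le ((hw _).sub (hw _)) ((hw _).sub (hw _)) one_le_two
      _ ≤ ε (q + m) + ∑ i ∈ Finset.range m, ε (q + i) := add_le_add (hε _) ih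
      _ = _ := add_comm _ _

/-- `‖w_m - w_q‖_{L²} ≤ ∑_{i ≥ 0} ε_{q+i}` for `q ≤ m`. [folklore] -/
theorem eLpNorm_sub_le_tsum_of_le {w : ℕ → α → E} {ε : ℕ → ℝ≥0∞}
    (hw : ∀ n, AEStronglyMeasurable (w n) μ) (hε : ∀ n, eLpNorm (w (n + 1) - w n) 2 μ ≤ ε n)
    {q m : ℕ} (hqm : q ≤ m) : eLpNorm (w m - w q) 2 μ ≤ ∑' i, ε (q + i) := by
  obtain ⟨n, rfl⟩ := Nat.exists_eq_add_of_le hqm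
  exact (eLpNorm_sub_le_sum_of_le hw hε q n).trans (ENNReal.sum_le_tsum _)

/-- **Summable `L²` increments force a.e. convergence** (on a probability space): if
`∑ ‖w_{n+1} - w_n‖_{L²} < ∞` then `∑ ‖w_{n+1}(x) - w_n(x)‖ < ∞` for a.e. `x` (monotone
convergence and `‖·‖_{L¹} ≤ ‖·‖_{L²}`), so `(w_n(x))` is Cauchy a.e. [folklore] -/
theorem ae_cauchySeq_of_tsum_eLpNorm_ne_top [IsProbabilityMeasure μ] {w : ℕ → α → E}
    (hw : ∀ n, AEStronglyMeasurable (w n) μ)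
    (hsum : ∑' n, eLpNorm (w (n + 1) - w n) 2 μ ≠ ⊤) : ∀ᵐ x ∂μ, CauchySeq (fun n => w n x) := by
  have hmeas : ∀ n, AEMeasurable (fun x => ‖w (n + 1) x - w n x‖ₑ) μ := fun n =>
    ((hw _).sub (hw _)).enorm
  have hG : ∫⁻ x, ∑' n, ‖w (n + 1) x - w n x‖ₑ ∂μ ≤ ∑' n, eLpNorm (w (n + 1) - w n) 2 μ := by
    rw [lintegral_tsum hmeas]
    refine ENNReal.tsum_le_tsum fun n => ?_
    have h1 : ∫⁻ x, ‖w (n + 1) x - w n x‖ₑ ∂μ = eLpNorm (w (n + 1) - w n) 1 μ := by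
      rw [eLpNorm_one_eq_lintegral_enorm]; rfl
    rw [h1]
    have h2 := eLpNorm_le_eLpNorm_mul_rpow_measure_univ (p := 1) (q := 2) (μ := μ) (by norm_num)
      ((hw (n + 1)).sub (hw n))
    simpa using h2
  have hfin : ∀ᵐ x ∂μ, ∑' n, ‖w (n + 1) x - w n x‖ₑ < ⊤ :=
    ae_lt_top' (AEMeasurable.tsum hmeas) (ne_top_of_le_ne_top hsum hG)
  filter_upwards [hfin] with x hx
  refine cauchySeq_of_edist_le_of_tsum_ne_top (fun n => ‖w (n + 1) x - w n x‖ₑ) (fun n => ?_) hx.ne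
  rw [edist_comm, edist_eq_enorm_sub]

variable [CompleteSpace E] [IsProbabilityMeasure μ]

/-- A.e. convergence to the pointwise `limUnder` under summable `L²` increments. [folklore] -/
theorem ae_tendsto_limUnder_of_tsum_eLpNorm_ne_top {w : ℕ → α → E}
    (hw : ∀ n, AEStronglyMeasurable (w n) μ)
    (hsum : ∑' n, eLpNorm (w (n + 1) - w n) 2 μ ≠ ⊤) :
    ∀ᵐ x ∂μ, Tendsto (fun n => w n x) atTop (𝓝 (limUnder atTop fun n => w n x)) := by
  filter_upwards [ae_cauchySeq_of_tsum_eLpNorm_ne_top hw hsum] with x hx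
  exact tendsto_nhds_limUnder (cauchySeq_tendsto_of_complete hx)

/-- **Fatou tail bound.** Under summable `L²` increments `‖w_{n+1} - w_n‖_{L²} ≤ ε_n`,
`∑ ε_n < ∞`, the pointwise limit `w = limUnder w_n` satisfies `‖w - w_q‖_{L²} ≤ ∑_{i ≥ 0} ε_{q+i}`
for every `q` (Fatou's lemma applied to `‖w_n - w_q‖²`, which converges a.e.). [folklore] -/
theorem eLpNorm_limUnder_sub_le_tsum {w : ℕ → α → E} {ε : ℕ → ℝ≥0∞}
    (hw : ∀ n, AEStronglyMeasurable (w n) μ) (hε : ∀ n, eLpNorm (w (n + 1) - w n) 2 μ ≤ ε n)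
    (hsum : ∑' n, ε n ≠ ⊤) (q : ℕ) :
    eLpNorm (fun x => (limUnder atTop fun n => w n x) - w q x) 2 μ ≤ ∑' i, ε (q + i) := by
  set u : α → E := fun x => limUnder atTop fun n => w n x with hu
  have hsum' : ∑' n, eLpNorm (w (n + 1) - w n) 2 μ ≠ ⊤ :=
    ne_top_of_le_ne_top hsum (ENNReal.tsum_le_tsum hε)
  have hae := ae_tendsto_limUnder_of_tsum_eLpNorm_ne_top hw hsum'
  have hpt : ∀ᵐ x ∂μ, ‖u x - w q x‖ₑ ^ 2 = liminf (fun n => ‖w n x - w q x‖ₑ ^ 2) atTop := by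
    filter_upwards [hae] with x hx
    have h : Tendsto (fun n => ‖w n x - w q x‖ₑ ^ 2) atTop (𝓝 (‖u x - w q x‖ₑ ^ 2)) :=
      ENNReal.Tendsto.pow ((hx.sub_const (w q x)).enorm)
    exact h.liminf_eq.symm
  have h2 : ∫⁻ x, ‖u x - w q x‖ₑ ^ 2 ∂μ ≤ (∑' i, ε (q + i)) ^ 2 := by
    calc ∫⁻ x, ‖u x - w q x‖ₑ ^ 2 ∂μ
        = ∫⁻ x, liminf (fun n => ‖w n x - w q x‖ₑ ^ 2) atTop ∂μ := lintegral_congr_ae hpt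
      _ ≤ liminf (fun n => ∫⁻ x, ‖w n x - w q x‖ₑ ^ 2 ∂μ) atTop :=
          lintegral_liminf_le' fun n => ((hw n).sub (hw q)).enorm.pow_const 2
      _ ≤ (∑' i, ε (q + i)) ^ 2 := by
          refine liminf_le_of_frequently_le (Eventually.frequently ?_)
          filter_upwards [eventually_ge_atTop q] with n hn
          have h := eLpNorm_sub_le_tsum_of_le hw hε hn
          rw [← eLpNorm_two_sq_eq_lintegral]
          change eLpNorm (w n - w q) 2 μ ^ 2 ≤ (∑' i, ε (q + i)) ^ 2
          gcongr
  have h3 : eLpNorm (fun x => u x - w q x) 2 μ ^ 2 ≤ (∑' i, ε (q + i)) ^ 2 := by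
    rw [eLpNorm_two_sq_eq_lintegral]
    exact h2
  exact (ENNReal.pow_le_pow_left_iff two_ne_zero).1 h3

end L2Cauchy

/-! ## Weak solutions are stable under strong `L²_{t,x}` limits at fixed viscosity -/

section WeakLimit

variable {d : Type*} [Fintype d] [DecidableEq d]
variable {T ν : ℝ} {u : ℝ → UnitAddTorus d → EuclideanSpace ℝ d}

/-- **Strong `L²((0,T) × T^d)` limits of approximate weak Navier–Stokes solutions are weak
solutions** (fixed viscosity `ν`). Let `u_m` be jointly measurable fields in `L²((0,T) × T^d)`,
weakly divergence free at a.e. time, whose weak Navier–Stokes defect against every divergence-free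
test field supported in `(0,T)` tends to zero,
`∫₀ᵀ∫ (⟪u_m, ∂ₜψ⟫ + ⟪u_m, (u_m·∇)ψ⟫ + ν⟪u_m, Δψ⟫) → 0`, and let `u_m → u` in `L²((0,T) × T^d)` with
`u` jointly measurable and in `L²`. Then `u` is a weak solution (`Torus.IsWeakNSSolutionOn T ν u`).
The convergence of the weak momentum integrals is the Cauchy–Schwarz bookkeeping of the tree's
`Torus.isWeakEulerSolutionOn_of_inviscidLimit` with the (fixed) viscous term `ν⟪u, Δψ⟫` absorbed
into the linear term `⟪u, ∂ₜψ + νΔψ⟫`; weak incompressibility passes to the limit by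
`Torus.ae_isWeaklyDivFree_of_tendsto_lintegral`. This is the sentence "since `‖R̊_q‖_{L¹} → 0` as
`q → ∞`, `v` is a weak solution of the Navier–Stokes equation" of BV19 §2.4 (the defect of the
Navier–Stokes–Reynolds iterates is `∫∫ R̊_q : ∇ψ`). [folklore] -/
theorem isWeakNSSolutionOn_of_tendsto_L2_of_defect
    {useq : ℕ → ℝ → UnitAddTorus d → EuclideanSpace ℝ d}
    (hmeas_seq : ∀ m, AEStronglyMeasurable (Torus.stLift (useq m)) (volume.restrict (Ioo 0 T ×ˢ univ)))
    (h2_seq : ∀ m, ∫⁻ t in Ioo 0 T, ∫⁻ x, ‖useq m t x‖ₑ ^ 2 < ⊤)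
    (hdiv_seq : ∀ m, ∀ᵐ t ∂(volume.restrict (Ioo 0 T)), Torus.IsWeaklyDivFree (useq m t))
    (hdefect : ∀ ψ : ℝ → UnitAddTorus d → EuclideanSpace ℝ d, Torus.IsSpaceTimeTestIoo T ψ →
      Torus.IsDivFreeTest ψ →
      Tendsto (fun m => ∫ t in Ioo 0 T, ∫ x, (⟪useq m t x, Torus.timeDeriv ψ t x⟫_ℝ +
        ⟪useq m t x, Torus.convect (useq m t) (ψ t) x⟫_ℝ +
        ν * ⟪useq m t x, Torus.laplacian (ψ t) x⟫_ℝ)) atTop (𝓝 0))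
    (hmeas : AEStronglyMeasurable (Torus.stLift u) (volume.restrict (Ioo 0 T ×ˢ univ)))
    (hu2 : ∫⁻ t in Ioo 0 T, ∫⁻ x, ‖u t x‖ₑ ^ 2 < ⊤)
    (hconv : Tendsto (fun m => ∫⁻ t in Ioo 0 T, ∫⁻ x, ‖useq m t x - u t x‖ₑ ^ 2) atTop (𝓝 0)) :
    Torus.IsWeakNSSolutionOn T ν u := by
  set μT := (volume.restrict (Ioo 0 T)).prod (volume : Measure (UnitAddTorus d)) with hμT
  have hum : AEStronglyMeasurable (uncurry u) μT := Torus.aestronglyMeasurable_uncurry_prod hmeas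
  have hvm : ∀ k, AEStronglyMeasurable (uncurry (useq k)) μT := fun k =>
    Torus.aestronglyMeasurable_uncurry_prod (hmeas_seq k)
  refine ⟨hmeas, hu2, ?_, fun ψ hψ hdiv => ?_⟩
  · exact Torus.ae_isWeaklyDivFree_of_tendsto_lintegral hvm hdiv_seq hum hu2 hconv
  -- the test-derived fields: `δ = ∂ₜψ + νΔψ`, `B = Dψ`
  have h0 : Torus.IsSmoothSpaceTimeOn univ ψ := hψ.isSpaceTimeTest.isSmoothSpaceTimeOn univ
  have hdt : Torus.IsSmoothSpaceTimeOn univ (Torus.timeDeriv ψ) :=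
    hψ.isSpaceTimeTest.timeDeriv.isSmoothSpaceTimeOn univ
  have hB : Torus.IsSmoothSpaceTimeOn univ (fun t x => Torus.fderiv (ψ t) x) :=
    h0.torusFderiv uniqueDiffOn_univ
  have hL : Torus.IsSmoothSpaceTimeOn univ (fun t => Torus.laplacian (ψ t)) :=
    h0.laplacian uniqueDiffOn_univ
  have hδs : Torus.IsSmoothSpaceTimeOn univ
      (fun t x => Torus.timeDeriv ψ t x + ν • Torus.laplacian (ψ t) x) :=
    hdt.add (hL.const_smul ν)
  obtain ⟨⟨Cδ, hCδ0, hCδ⟩, hδm⟩ := hδs.bound_and_measurable T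
  obtain ⟨⟨CB, hCB0, hCB⟩, hBm⟩ := hB.bound_and_measurable T
  obtain ⟨⟨Cdt, hCdt0, hCdt⟩, hdtm⟩ := hdt.bound_and_measurable T
  obtain ⟨⟨CL, hCL0, hCL⟩, hLm⟩ := hL.bound_and_measurable T
  -- a.e. `t ∈ (0, T)` and the test bounds
  have hIoo : ∀ᵐ z ∂μT, z.1 ∈ Icc 0 T := by
    rw [hμT, ← Torus.volume_restrict_Ioo_prod_univ]
    filter_upwards [ae_restrict_mem (measurableSet_Ioo.prod MeasurableSet.univ)] with z hz
    exact Ioo_subset_Icc_self hz.1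
  have bδ : ∀ᵐ z ∂μT, ‖Torus.timeDeriv ψ z.1 z.2 + ν • Torus.laplacian (ψ z.1) z.2‖ ≤ Cδ := by
    filter_upwards [hIoo] with z hz
    exact hCδ z.1 hz z.2
  have bB : ∀ᵐ z ∂μT, ‖Torus.fderiv (ψ z.1) z.2‖ ≤ CB := by
    filter_upwards [hIoo] with z hz
    exact hCB z.1 hz z.2
  have bL0 : ∀ᵐ z ∂μT, ‖(0 : EuclideanSpace ℝ d)‖ ≤ (0 : ℝ) := ae_of_all _ fun _ => by simp
  have bdt : ∀ᵐ z ∂μT, ‖Torus.timeDeriv ψ z.1 z.2‖ ≤ Cdt := by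
    filter_upwards [hIoo] with z hz
    exact hCdt z.1 hz z.2
  have bL : ∀ᵐ z ∂μT, ‖Torus.laplacian (ψ z.1) z.2‖ ≤ CL := by
    filter_upwards [hIoo] with z hz
    exact hCL z.1 hz z.2
  -- integrability of the weak momentum integrands (any `L²_{t,x}` field)
  have hInt : ∀ {v : ℝ → UnitAddTorus d → EuclideanSpace ℝ d},
      AEStronglyMeasurable (uncurry v) μT → (∫⁻ t in Ioo 0 T, ∫⁻ x, ‖v t x‖ₑ ^ 2 < ⊤) →
      Integrable (fun z : ℝ × UnitAddTorus d => ⟪v z.1 z.2, Torus.timeDeriv ψ z.1 z.2⟫_ℝ +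
        ⟪v z.1 z.2, Torus.fderiv (ψ z.1) z.2 (v z.1 z.2)⟫_ℝ +
        ν * ⟪v z.1 z.2, Torus.laplacian (ψ z.1) z.2⟫_ℝ) μT := by
    intro v hv hv2
    have e2 : ∫⁻ t in Ioo 0 T, ∫⁻ x, ‖v t x‖ₑ ^ 2 = ∫⁻ z, ‖v z.1 z.2‖ₑ ^ 2 ∂μT :=
      Torus.lintegral_Ioo_lintegral_eq_lintegral_prod (hv.enorm.pow_const _)
    rw [e2] at hv2
    have hM2 : MemLp (uncurry v) 2 μT :=
      ⟨hv, (eLpNorm_lt_top_iff_lintegral_rpow_enorm_lt_top two_ne_zero ENNReal.ofNat_ne_top).2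
        (by simpa [uncurry] using hv2)⟩
    have I1 : Integrable (fun z => ‖v z.1 z.2‖) μT := (hM2.integrable one_le_two).norm
    have I2 : Integrable (fun z => ‖v z.1 z.2‖ ^ 2) μT := (memLp_two_iff_integrable_sq_norm hv).1 hM2
    have hBv : AEStronglyMeasurable (fun z : ℝ × UnitAddTorus d =>
        Torus.fderiv (ψ z.1) z.2 (v z.1 z.2)) μT :=
      (show Continuous (fun p : (EuclideanSpace ℝ d →L[ℝ] EuclideanSpace ℝ d) × EuclideanSpace ℝ d =>
        p.1 p.2) from isBoundedBilinearMap_apply.continuous).comp_aestronglyMeasurable₂ hBm hv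
    have hmeasI : AEStronglyMeasurable (fun z : ℝ × UnitAddTorus d =>
        ⟪v z.1 z.2, Torus.timeDeriv ψ z.1 z.2⟫_ℝ +
        ⟪v z.1 z.2, Torus.fderiv (ψ z.1) z.2 (v z.1 z.2)⟫_ℝ +
        ν * ⟪v z.1 z.2, Torus.laplacian (ψ z.1) z.2⟫_ℝ) μT :=
      ((hv.inner hdtm).add (hv.inner hBv)).add (aestronglyMeasurable_const.mul (hv.inner hLm))
    refine Integrable.mono' ((I1.const_mul (Cdt + |ν| * CL)).add (I2.const_mul CB)) hmeasI ?_
    filter_upwards [bdt, bB, bL] with z h1 h2 h3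
    set a := v z.1 z.2 with ha
    have ha0 : 0 ≤ ‖a‖ := norm_nonneg _
    have k1 : |⟪a, Torus.timeDeriv ψ z.1 z.2⟫_ℝ| ≤ ‖a‖ * Cdt :=
      (abs_real_inner_le_norm _ _).trans (mul_le_mul_of_nonneg_left h1 ha0)
    have k2 : |⟪a, Torus.fderiv (ψ z.1) z.2 a⟫_ℝ| ≤ ‖a‖ * (CB * ‖a‖) :=
      (abs_real_inner_le_norm _ _).trans (mul_le_mul_of_nonneg_left
        (((Torus.fderiv (ψ z.1) z.2).le_opNorm a).trans (mul_le_mul_of_nonneg_right h2 ha0)) ha0)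
    have k3 : |ν * ⟪a, Torus.laplacian (ψ z.1) z.2⟫_ℝ| ≤ |ν| * (‖a‖ * CL) := by
      rw [abs_mul]
      exact mul_le_mul_of_nonneg_left ((abs_real_inner_le_norm _ _).trans
        (mul_le_mul_of_nonneg_left h3 ha0)) (abs_nonneg _)
    rw [Real.norm_eq_abs]
    refine (abs_add_le _ _).trans ((add_le_add ((abs_add_le _ _).trans (add_le_add k1 k2)) k3).trans ?_)
    simp only [Pi.add_apply]
    nlinarith [sq_nonneg ‖a‖]
  have IF := hInt hum hu2
  have IFm : ∀ k, Integrable (fun z : ℝ × UnitAddTorus d =>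
      ⟪useq k z.1 z.2, Torus.timeDeriv ψ z.1 z.2⟫_ℝ +
      ⟪useq k z.1 z.2, Torus.fderiv (ψ z.1) z.2 (useq k z.1 z.2)⟫_ℝ +
      ν * ⟪useq k z.1 z.2, Torus.laplacian (ψ z.1) z.2⟫_ℝ) μT := fun k => hInt (hvm k) (h2_seq k)
  -- the weak momentum defects of the approximants, in product form
  have hzero : Tendsto (fun k => ∫ z, (⟪useq k z.1 z.2, Torus.timeDeriv ψ z.1 z.2⟫_ℝ +
      ⟪useq k z.1 z.2, Torus.fderiv (ψ z.1) z.2 (useq k z.1 z.2)⟫_ℝ +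
      ν * ⟪useq k z.1 z.2, Torus.laplacian (ψ z.1) z.2⟫_ℝ) ∂μT) atTop (𝓝 0) := by
    refine (hdefect ψ hψ hdiv).congr fun k => ?_
    rw [integral_prod _ (IFm k)]
    rfl
  -- the limit identity, in product form
  suffices hlim : Tendsto (fun k => ∫ z, (⟪useq k z.1 z.2, Torus.timeDeriv ψ z.1 z.2⟫_ℝ +
      ⟪useq k z.1 z.2, Torus.fderiv (ψ z.1) z.2 (useq k z.1 z.2)⟫_ℝ +
      ν * ⟪useq k z.1 z.2, Torus.laplacian (ψ z.1) z.2⟫_ℝ) ∂μT) atTop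
      (𝓝 (∫ z, (⟪u z.1 z.2, Torus.timeDeriv ψ z.1 z.2⟫_ℝ +
        ⟪u z.1 z.2, Torus.fderiv (ψ z.1) z.2 (u z.1 z.2)⟫_ℝ +
        ν * ⟪u z.1 z.2, Torus.laplacian (ψ z.1) z.2⟫_ℝ) ∂μT)) by
    have h := tendsto_nhds_unique hlim hzero
    change ∫ t in Ioo 0 T, ∫ x, (⟪u t x, Torus.timeDeriv ψ t x⟫_ℝ +
      ⟪u t x, Torus.fderiv (ψ t) x (u t x)⟫_ℝ + ν * ⟪u t x, Torus.laplacian (ψ t) x⟫_ℝ) = 0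
    rw [show (∫ t in Ioo 0 T, ∫ x, (⟪u t x, Torus.timeDeriv ψ t x⟫_ℝ +
      ⟪u t x, Torus.fderiv (ψ t) x (u t x)⟫_ℝ + ν * ⟪u t x, Torus.laplacian (ψ t) x⟫_ℝ)) =
      ∫ z, (⟪u z.1 z.2, Torus.timeDeriv ψ z.1 z.2⟫_ℝ +
        ⟪u z.1 z.2, Torus.fderiv (ψ z.1) z.2 (u z.1 z.2)⟫_ℝ +
        ν * ⟪u z.1 z.2, Torus.laplacian (ψ z.1) z.2⟫_ℝ) ∂μT from (integral_prod _ IF).symm]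
    exact h
  refine tendsto_integral_of_L1 _ IF.aestronglyMeasurable (Eventually.of_forall IFm) ?_
  -- the `L¹` distance → 0: absorb `νΔψ` into the linear term and reuse the Euler bookkeeping
  have mNb : AEMeasurable (fun z : ℝ × UnitAddTorus d => ‖u z.1 z.2‖ₑ) μT := hum.enorm
  have mE : ∀ k, AEMeasurable (fun z : ℝ × UnitAddTorus d => ‖useq k z.1 z.2 - u z.1 z.2‖ₑ) μT :=
    fun k => (show AEStronglyMeasurable (fun z : ℝ × UnitAddTorus d => useq k z.1 z.2 - u z.1 z.2) μT
      from (hvm k).sub hum).enorm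
  have hA : Tendsto (fun k => ∫⁻ z, ‖useq k z.1 z.2 - u z.1 z.2‖ₑ ^ 2 ∂μT) atTop (𝓝 0) := by
    refine hconv.congr fun k => ?_
    exact Torus.lintegral_Ioo_lintegral_eq_lintegral_prod ((mE k).pow_const _)
  have hN2 : ∫⁻ z, ‖u z.1 z.2‖ₑ ^ 2 ∂μT < ⊤ := by
    have e : ∫⁻ t in Ioo 0 T, ∫⁻ x, ‖u t x‖ₑ ^ 2 = ∫⁻ z, ‖u z.1 z.2‖ₑ ^ 2 ∂μT :=
      Torus.lintegral_Ioo_lintegral_eq_lintegral_prod (mNb.pow_const _)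
    rw [← e]; exact hu2
  have hlim := Torus.tendsto_momentumBound (c₁ := ENNReal.ofReal Cδ) (c₂ := ENNReal.ofReal CB)
    (c₃ := ENNReal.ofReal 0) ENNReal.ofReal_ne_top ENNReal.ofReal_ne_top ENNReal.ofReal_ne_top
    hN2.ne (measure_ne_top μT univ) hA (tendsto_const_nhds (x := (0 : ℝ≥0∞)))
  refine tendsto_of_tendsto_of_tendsto_of_le_of_le' tendsto_const_nhds hlim
    (Eventually.of_forall fun _ => zero_le) (Eventually.of_forall fun k => ?_)
  have hkey := Torus.lintegral_enorm_momentumFlux_sub_le μT (0 : ℝ)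
    (a := fun z => useq k z.1 z.2) (b := fun z => u z.1 z.2)
    (δ := fun z => Torus.timeDeriv ψ z.1 z.2 + ν • Torus.laplacian (ψ z.1) z.2)
    (L := fun _ => (0 : EuclideanSpace ℝ d)) (B := fun z => Torus.fderiv (ψ z.1) z.2)
    bδ bB bL0 (mE k) mNb
  rw [enorm_zero] at hkey
  refine le_trans (le_of_eq (lintegral_congr fun z => ?_)) hkey
  congr 1
  simp only [inner_add_right, real_inner_smul_right, inner_zero_right, mul_zero, add_zero]
  ring


/-- **Strong `L²((0,T) × T^d)` limits of weak Navier–Stokes solutions are weak solutions** (fixed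
viscosity; the defect-free case of `isWeakNSSolutionOn_of_tendsto_L2_of_defect`). [folklore] -/
theorem isWeakNSSolutionOn_of_tendsto_L2 {useq : ℕ → ℝ → UnitAddTorus d → EuclideanSpace ℝ d}
    (hsol : ∀ m, Torus.IsWeakNSSolutionOn T ν (useq m))
    (hmeas : AEStronglyMeasurable (Torus.stLift u) (volume.restrict (Ioo 0 T ×ˢ univ)))
    (hu2 : ∫⁻ t in Ioo 0 T, ∫⁻ x, ‖u t x‖ₑ ^ 2 < ⊤)
    (hconv : Tendsto (fun m => ∫⁻ t in Ioo 0 T, ∫⁻ x, ‖useq m t x - u t x‖ₑ ^ 2) atTop (𝓝 0)) :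
    Torus.IsWeakNSSolutionOn T ν u :=
  isWeakNSSolutionOn_of_tendsto_L2_of_defect (fun m => (hsol m).1) (fun m => (hsol m).2.1)
    (fun m => (hsol m).2.2.1)
    (fun ψ hψ hdiv => by simp only [fun m => (hsol m).2.2.2 ψ hψ hdiv]; exact tendsto_const_nhds)
    hmeas hu2 hconv

end WeakLimit

end Literature.Barriers.NavierStokesRegularity

end
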